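import Literature.Geometry.Kaehler.HolomorphicChainConstantPeriods
import Literature.Geometry.Kaehler.HolomorphicChainPlane
import Literature.Geometry.Kaehler.ComplexTorusPoincareDualHodgeClass
import Mathlib.MeasureTheory.Measure.Haar.InnerProductSpace
import HarnessLib

/-!
# Periods of the plane chain: the analytic period over the period parallelotope is the algebraic
# period functional (stage (i) validation of the cycle-class recipe)

Layer `Literature/Geometry/Kaehler`; lane `lit-hodgefound`, Layer A4, row A4-18 (b) stage (ii)
(`run/shared/lean/pub/lit-hodgefound/SKELETON.md` §P Q58, node N8a of
`lit-hodgefound-p07/Q58-STAGING.md`). The plane chain `[K] = HolomorphicChain.plane K hK` of a complex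
`p`-plane `K ⊆ V` (`HolomorphicChainPlane.lean`: carrier `K`, density `1`, orientation the canonical
`2p`-vector `u₀ ∧ i u₀ ∧ ⋯` of a unitary basis `u`, and `𝓗^{2p} ⌞ K` = Lebesgue measure of `K`) is the
universal cover of a complex sub-torus `W/(W ∩ Λ)` of a complex torus `E/Λ`. We compute its periods
on CONSTANT forms (`HolomorphicChain.constPeriod`, `HolomorphicChainConstantPeriods.lean`):

* `HolomorphicChain.constPeriod_plane_apply` — over a Borel window `D` inside a compact set,
  `constPeriod [K] D ω = 𝓗^{2p}(D ∩ K) · ω(u₀, i u₀, …, u_{p-1}, i u_{p-1})` (Chirka (1989), §14.1: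
  `⟨[A], φ⟩ = ∫_{reg A} φ`; here `reg A = K` and the integrand is constant);
* `HolomorphicChain.measureReal_parallelepiped_eq_abs_det` — for a real `2p`-frame `w` of `K`, the
  `𝓗^{2p}`-measure of the period parallelotope `{Σ tᵢ wᵢ | t ∈ [0,1]^{2p}}` is `|det_{(u, iu)}(w)|`
  (Lebesgue measure of a parallelepiped in the orthonormal frame `(u₀, i u₀, …)`: Federer 3.2.3 and
  Mathlib's `addHaar_parallelepiped`);
* **`HolomorphicChain.constPeriod_plane_parallelepiped`** — hence
  `constPeriod [K] (parallelepiped w) ω = |det_{(u,iu)}(w)| · ω(u, iu, …)`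
  (`constPeriod_plane_parallelepiped_eq_abs_det_smul`), `= ω(w)` when `w` is POSITIVELY ORIENTED for the
  canonical complex orientation (`IsPosOriented`, row p08 — the same interleaved convention
  `(b₀, i b₀, b₁, i b₁, …)` as `complexFrame`, `realBasisOfComplex_reindex_apply`): **the analytic period
  of the flat chain over the period parallelotope of a positively oriented frame is the algebraic period
  `ω(w₀, …, w_{2p-1})`** (Voisin (2002), Cor. 11.15: `⟨[Z], α⟩_X = ∫_Z α_{|Z}`; Griffiths–Harris,
  Ch. 0 §2: the canonical orientation);
* **`ComplexTorus.SubtorusFrame.constPeriod_plane_eq_periodFunctional`** — for a complex sub-torus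
  datum `Z : SubtorusFrame Φ (2d)` of the torus `X = E/Φ(ℤ^ι)` (row p08: an oriented saturated
  `ℤ`-basis `u` of `W ∩ Λ`), the period functional of the plane chain `[W]` over the fundamental
  parallelotope of `W ∩ Λ` IS the period functional `periodFunctional (Φu)` of row p07's
  `ComplexTorusPoincareDualHodgeClass.lean`; consequently (`poincareDualForm_constPeriod_plane`) its
  Poincaré dual form is `sign(e) · cycleFormOfFrame` — the stage-(ii) recipe `[Z] := (∫_Z ·)^♭`,
  computed ANALYTICALLY (current of integration, Hausdorff measure), reproduces row p08's algebraic
  cycle class of stage (i).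

Theorems, and one private auxiliary definition (the real orthonormal basis `(u₀, i u₀, …)` of `K`); no
named fact.

## References

* [Chirka1989] E. M. Chirka, *Complex Analytic Sets*, Kluwer (1989), §14.1 Cor., p. 174.
* [VoisinHodgeI2002] C. Voisin, *Hodge Theory and Complex Algebraic Geometry I*, CUP (2002), §11.1.2
  Cor. 11.15, §11.1.3 Prop. 11.20.
* [Federer1969] H. Federer, *Geometric Measure Theory*, Springer (1969), 3.2.3 (area formula), 4.1.28.
* [Lange2023AbelianVarietiesComplex] H. Lange, *Abelian Varieties over the Complex Numbers*, Springer
  (2023), §1.1.1, Exercise 1.1.6 (2)(a).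
-/

noncomputable section

open scoped Manifold ENNReal NNReal
open MeasureTheory TopologicalSpace Set Function Complex Module
open Literature.Geometry.GeometricMeasureTheory

namespace Literature.Geometry.Kaehler

-- Nested operator-norm instances on `Covector V m` / `Multivector V m`, as in `Currents.lean`.
set_option maxSynthPendingDepth 2

universe u

/-! ### The interleaved real basis of a complex basis, slot by slot -/

/-- Row p08's interleaved real basis `(b₀, i b₀, b₁, i b₁, …)` of a complex basis `b`, reindexed to
`Fin (2q)`: slot `k` is `b_{k/2}` for even `k` and `i b_{k/2}` for odd `k` — the convention of
`complexFrame` (Griffiths–Harris, Ch. 0 §2: the canonical orientation `(x₁, y₁, …, x_q, y_q)`).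
[cite: VoisinHodgeI2002, §11.1.2 Cor. 11.15] -/
theorem realBasisOfComplex_reindex_apply {W : Type*} [AddCommGroup W] [Module ℂ W] {q : ℕ}
    (b : Basis (Fin q) ℂ W) (h : q * 2 = 2 * q) (k : Fin (2 * q)) :
    (realBasisOfComplex b).reindex (finCongr h) k =
      if Even (k : ℕ) then b ⟨(k : ℕ) / 2, by omega⟩ else I • b ⟨(k : ℕ) / 2, by omega⟩ := by
  rw [Basis.reindex_apply, realBasisOfComplex_apply, finProdFinEquiv_symm_apply, coe_basisOneI]
  have hdiv : ((finCongr h).symm k).divNat = ⟨(k : ℕ) / 2, by omega⟩ := Fin.ext (by simp [Fin.coe_divNat])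
  have hmodv : ((((finCongr h).symm k).modNat : Fin 2) : ℕ) = (k : ℕ) % 2 := by simp [Fin.coe_modNat]
  rw [hdiv]
  by_cases he : Even (k : ℕ)
  · have h0 : ((finCongr h).symm k).modNat = 0 :=
      Fin.ext (by rw [hmodv, Fin.val_zero]; exact Nat.even_iff.1 he)
    rw [if_pos he, h0]; simp
  · have h1 : ((finCongr h).symm k).modNat = 1 :=
      Fin.ext (by rw [hmodv, Fin.val_one]; exact Nat.odd_iff.1 (Nat.not_even_iff_odd.1 he))
    rw [if_neg he, h1]; simp

namespace HolomorphicChain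

section Frame

variable {V : Type u} [NormedAddCommGroup V] [InnerProductSpace ℂ V] (K : Submodule ℂ V) {p : ℕ}

/-! ### Complex-valued forms on frames with the same multivector -/

/-- Two frames with the same `m`-vector give the same value to every complex-valued constant form
(apply `frameVector ξ = frameVector ξ'` to the real and imaginary parts). [folklore] -/
private theorem apply_eq_of_frameVector_eq {m : ℕ} {ξ ξ' : Fin m → V}
    (h : frameVector ξ = frameVector ξ') (ω : V [⋀^Fin m]→L[ℝ] ℂ) : ω ξ = ω ξ' := by
  have hre := congrArg (fun M : Multivector V m ↦ M (reCLM.compContinuousAlternatingMap ω)) h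
  have him := congrArg (fun M : Multivector V m ↦ M (imCLM.compContinuousAlternatingMap ω)) h
  simp only [frameVector_apply, ContinuousLinearMap.compContinuousAlternatingMap_coe, Function.comp_apply,
    reCLM_apply, imCLM_apply] at hre him
  exact Complex.ext hre him

/-! ### The real orthonormal basis `(u₀, i u₀, …)` of `K` -/

/-- The vectors of the real frame `complexFrame u` of a unitary basis `u` of `K` lie in `K`. [folklore] -/
private theorem complexFrame_mem {u : Fin p → V}
    (hspan : ((Submodule.span ℝ (Set.range (complexFrame u)) : Submodule ℝ V) : Set V) = (K : Set V))
    (k : Fin (2 * p)) : complexFrame u k ∈ K := by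
  have h : complexFrame u k ∈
      ((Submodule.span ℝ (Set.range (complexFrame u)) : Submodule ℝ V) : Set V) :=
    Submodule.subset_span ⟨k, rfl⟩
  rw [hspan] at h
  exact h

/-- `(u₀, i u₀, …)` is orthonormal in the real inner product space underlying `K` (a unitary frame
gives a real orthonormal frame, `orthonormal_complexFrame`). [folklore] -/
private theorem orthonormal_complexFrame_cod {u : Fin p → V} (hu : Orthonormal ℂ u)
    (hspan : ((Submodule.span ℝ (Set.range (complexFrame u)) : Submodule ℝ V) : Set V) = (K : Set V)) :
    letI : InnerProductSpace ℝ K := InnerProductSpace.complexToReal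
    Orthonormal ℝ (fun k ↦ (⟨complexFrame u k, complexFrame_mem K hspan k⟩ : K)) := by
  letI : InnerProductSpace ℝ K := InnerProductSpace.complexToReal
  letI : InnerProductSpace ℝ V := InnerProductSpace.complexToReal
  have h := orthonormal_complexFrame hu
  rw [orthonormal_iff_ite] at h ⊢
  intro i j
  rw [← h i j, real_inner_eq_re_inner ℂ, real_inner_eq_re_inner ℂ, Submodule.coe_inner]

variable [FiniteDimensional ℂ V]

/-- `(u₀, i u₀, …)` spans `K` over `ℝ` (`2p = dim_ℝ K` orthonormal vectors). [folklore] -/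
private theorem span_complexFrame_cod_eq_top (hK : finrank ℂ K = p) {u : Fin p → V}
    (hu : Orthonormal ℂ u)
    (hspan : ((Submodule.span ℝ (Set.range (complexFrame u)) : Submodule ℝ V) : Set V) = (K : Set V)) :
    Submodule.span ℝ (Set.range fun k ↦ (⟨complexFrame u k, complexFrame_mem K hspan k⟩ : K)) = ⊤ := by
  letI : InnerProductSpace ℝ K := InnerProductSpace.complexToReal
  exact (orthonormal_complexFrame_cod K hu hspan).linearIndependent.span_eq_top_of_card_eq_finrank'
    (by rw [Fintype.card_fin, finrank_real_of_complex, hK])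

/-- The real frame `(u₀, i u₀, …)` of a unitary basis `u` of `K`, as an ORTHONORMAL BASIS of the real
inner product space underlying `K`. [folklore] -/
private def complexFrameBasis (hK : finrank ℂ K = p) {u : Fin p → V} (hu : Orthonormal ℂ u)
    (hspan : ((Submodule.span ℝ (Set.range (complexFrame u)) : Submodule ℝ V) : Set V) = (K : Set V)) :
    letI : InnerProductSpace ℝ K := InnerProductSpace.complexToReal
    OrthonormalBasis (Fin (2 * p)) ℝ K :=
  letI : InnerProductSpace ℝ K := InnerProductSpace.complexToReal
  OrthonormalBasis.mk (orthonormal_complexFrame_cod K hu hspan) (span_complexFrame_cod_eq_top K hK hu hspan).ge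

/-- The vectors of `complexFrameBasis` are the `complexFrame u k`. [folklore] -/
private theorem coe_complexFrameBasis_apply (hK : finrank ℂ K = p) {u : Fin p → V}
    (hu : Orthonormal ℂ u)
    (hspan : ((Submodule.span ℝ (Set.range (complexFrame u)) : Submodule ℝ V) : Set V) = (K : Set V))
    (k : Fin (2 * p)) :
    letI : InnerProductSpace ℝ K := InnerProductSpace.complexToReal
    ((complexFrameBasis K hK hu hspan k : K) : V) = complexFrame u k := by
  letI : InnerProductSpace ℝ K := InnerProductSpace.complexToReal
  rw [complexFrameBasis, OrthonormalBasis.coe_mk]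

/-! ### A constant `2p`-form is a top form on the real `2p`-space `K` -/

/-- **`ω(w) = det_{(u, iu)}(w) · ω(u₀, i u₀, …)`** for `w₀, …, w_{2p-1} ∈ K`: restricted to the real
`2p`-dimensional space `K` a `2p`-form is a multiple of the determinant (Mathlib's
`AlternatingMap.eq_smul_basis_det` applied to the real and imaginary parts). [folklore] -/
private theorem apply_eq_det_mul_apply_complexFrame (hK : finrank ℂ K = p) {u : Fin p → V}
    (hu : Orthonormal ℂ u)
    (hspan : ((Submodule.span ℝ (Set.range (complexFrame u)) : Submodule ℝ V) : Set V) = (K : Set V))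
    {w : Fin (2 * p) → V} (hw : ∀ i, w i ∈ K) (ω : V [⋀^Fin (2 * p)]→L[ℝ] ℂ) :
    letI : InnerProductSpace ℝ K := InnerProductSpace.complexToReal
    ω w = (((complexFrameBasis K hK hu hspan).toBasis.det fun i ↦ (⟨w i, hw i⟩ : K)) : ℂ) *
      ω (complexFrame u) := by
  letI iK : InnerProductSpace ℝ K := InnerProductSpace.complexToReal
  -- `ω` restricted to `K`
  have hωK_apply : ∀ v : Fin (2 * p) → K,
      ω.compContinuousLinearMap ((K.subtypeL).restrictScalars ℝ) v = ω (fun i ↦ (v i : V)) := fun v ↦ rfl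
  have hcoe_b : (fun i ↦ (((complexFrameBasis K hK hu hspan).toBasis i : K) : V)) = complexFrame u := by
    funext i; rw [OrthonormalBasis.coe_toBasis]; exact coe_complexFrameBasis_apply K hK hu hspan i
  have hw_eq : ω w =
      ω.compContinuousLinearMap ((K.subtypeL).restrictScalars ℝ) fun i ↦ (⟨w i, hw i⟩ : K) := by
    rw [hωK_apply]
  have hu_eq : ω (complexFrame u) =
      ω.compContinuousLinearMap ((K.subtypeL).restrictScalars ℝ) (complexFrameBasis K hK hu hspan).toBasis := by
    rw [hωK_apply, ← hcoe_b]
  have hre := AlternatingMap.eq_smul_basis_det (complexFrameBasis K hK hu hspan).toBasis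
    (reCLM.compContinuousAlternatingMap
      (ω.compContinuousLinearMap ((K.subtypeL).restrictScalars ℝ))).toAlternatingMap
  have him := AlternatingMap.eq_smul_basis_det (complexFrameBasis K hK hu hspan).toBasis
    (imCLM.compContinuousAlternatingMap
      (ω.compContinuousLinearMap ((K.subtypeL).restrictScalars ℝ))).toAlternatingMap
  have hre' := congrArg (fun f : K [⋀^Fin (2 * p)]→ₗ[ℝ] ℝ ↦ f fun i ↦ (⟨w i, hw i⟩ : K)) hre
  have him' := congrArg (fun f : K [⋀^Fin (2 * p)]→ₗ[ℝ] ℝ ↦ f fun i ↦ (⟨w i, hw i⟩ : K)) him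
  simp only [AlternatingMap.smul_apply, ContinuousAlternatingMap.coe_toAlternatingMap,
    ContinuousLinearMap.compContinuousAlternatingMap_coe, Function.comp_apply, reCLM_apply, imCLM_apply,
    smul_eq_mul] at hre' him'
  rw [hw_eq, hu_eq]
  apply Complex.ext
  · rw [hre', re_ofReal_mul, mul_comm]
  · rw [him', im_ofReal_mul, mul_comm]

/-- **Positive orientation means positive determinant in the frame `(u₀, i u₀, …)`**: row p08's
`IsPosOriented` (positive determinant in the interleaved real basis of SOME complex basis) tested in the
complex basis `u` of `K` (`isPosOriented_iff`: the sign does not depend on the complex basis).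
[cite: VoisinHodgeI2002, §11.1.2 Cor. 11.15] -/
private theorem det_complexFrameBasis_pos (hK : finrank ℂ K = p) {u : Fin p → V}
    (hu : Orthonormal ℂ u)
    (hspan : ((Submodule.span ℝ (Set.range (complexFrame u)) : Submodule ℝ V) : Set V) = (K : Set V))
    {w : Fin (2 * p) → K} (hpos : IsPosOriented w) :
    letI : InnerProductSpace ℝ K := InnerProductSpace.complexToReal
    0 < (complexFrameBasis K hK hu hspan).toBasis.det w := by
  letI iK : InnerProductSpace ℝ K := InnerProductSpace.complexToReal
  -- `u` as a complex basis of `K`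
  have huK : ∀ j, u j ∈ K := fun j ↦ by
    have h := complexFrame_mem K hspan ⟨2 * j, by omega⟩
    rwa [complexFrame_apply_even] at h
  have hli : LinearIndependent ℂ (fun j ↦ (⟨u j, huK j⟩ : K)) :=
    LinearIndependent.of_comp K.subtype (by exact hu.linearIndependent)
  have hsp : ⊤ ≤ Submodule.span ℂ (Set.range fun j ↦ (⟨u j, huK j⟩ : K)) :=
    (hli.span_eq_top_of_card_eq_finrank' (by rw [Fintype.card_fin, hK])).ge
  have h2 : p * 2 = 2 * p := mul_comm _ _
  rw [isPosOriented_iff h2 (Basis.mk hli hsp)] at hpos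
  -- the two interleaved real bases coincide
  have hbases : (realBasisOfComplex (Basis.mk hli hsp)).reindex (finCongr h2) =
      (complexFrameBasis K hK hu hspan).toBasis := by
    refine Basis.eq_of_apply_eq fun k ↦ Subtype.ext ?_
    rw [realBasisOfComplex_reindex_apply, OrthonormalBasis.coe_toBasis,
      coe_complexFrameBasis_apply K hK hu hspan k]
    unfold complexFrame
    by_cases he : Even (k : ℕ)
    · rw [if_pos he, if_pos he, Basis.mk_apply]
    · rw [if_neg he, if_neg he, Submodule.coe_smul, Basis.mk_apply]
  rwa [hbases] at hpos

end Frame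

section Periods

variable {V : Type u} [NormedAddCommGroup V] [InnerProductSpace ℂ V] [FiniteDimensional ℂ V]
  [MeasurableSpace V] [BorelSpace V] (K : Submodule ℂ V) {p : ℕ}

/-! ### The period of the plane chain over a window -/

/-- **The period of the plane chain `[K]` on a constant form over a window**: for a Borel window `D`
inside a compact set, `constPeriod [K] D ω = 𝓗^{2p}(D ∩ K) · ω(u₀, i u₀, …)` for any unitary basis `u`
of `K` — the carrier is `K`, the density `1`, the orientation the canonical `2p`-vector of `K`
(`frameVector_orientationFrame_plane`), so the integrand of `⟨[K], ·⟩ = ∫_K ·` (Chirka (1989), §14.1)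
is constant. [cite: Chirka1989, §14.1 Cor., p. 174] -/
theorem constPeriod_plane_apply (hK : finrank ℂ K = p) {u : Fin p → V} (hu : Orthonormal ℂ u)
    (hspan : ((Submodule.span ℝ (Set.range (complexFrame u)) : Submodule ℝ V) : Set V) = (K : Set V))
    {D C : Set V} (hDm : MeasurableSet D) (hDC : D ⊆ C) (hC : IsCompact C)
    (ω : V [⋀^Fin (2 * p)]→L[ℝ] ℂ) :
    (plane K hK).constPeriod D ω = (μHE[2 * p] : Measure V).real (D ∩ K) • ω (complexFrame u) := by
  rw [(plane K hK).constPeriod_apply_of_subset_isCompact hDC hC (fun _ _ ↦ trivial) ω, carrier_plane,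
    Measure.restrict_restrict hDm]
  have hKm : MeasurableSet (K : Set V) := K.closed_of_finiteDimensional.measurableSet
  have hpt : ∀ x ∈ D ∩ (K : Set V),
      (((plane K hK).density x : ℝ) : ℂ) * ω ((plane K hK).orientationFrame x) = ω (complexFrame u) := by
    rintro x ⟨-, hx⟩
    rw [density_plane_of_mem K hK hx, Int.cast_one, ofReal_one, one_mul]
    exact apply_eq_of_frameVector_eq (frameVector_orientationFrame_plane K hK hu hspan hx) ω
  rw [setIntegral_congr_fun (hDm.inter hKm) hpt, setIntegral_const]

/-! ### The period parallelotope of a real frame of `K` -/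

omit [FiniteDimensional ℂ V] [MeasurableSpace V] [BorelSpace V] in
/-- A parallelepiped spanned by vectors of `K` lies in `K`. [folklore] -/
private theorem parallelepiped_subset {m : ℕ} {w : Fin m → V} (hw : ∀ i, w i ∈ K) :
    parallelepiped w ⊆ (K : Set V) := by
  intro x hx
  rw [mem_parallelepiped_iff] at hx
  obtain ⟨t, -, rfl⟩ := hx
  exact K.sum_mem fun i _ ↦ (K.restrictScalars ℝ).smul_mem (t i) (hw i)

omit [FiniteDimensional ℂ V] [MeasurableSpace V] [BorelSpace V] in
/-- A parallelepiped is compact (the image of the cube under a continuous map). [folklore] -/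
private theorem isCompact_parallelepiped' {m : ℕ} (w : Fin m → V) : IsCompact (parallelepiped w) :=
  isCompact_Icc.image (continuous_finsetSum _ fun i _ ↦ (continuous_apply i).smul continuous_const)

/-- **`𝓗^{2p}` of the period parallelotope of a real frame of `K` is `|det_{(u, iu)}|`**: for
`w₀, …, w_{2p-1} ∈ K`, `𝓗^{2p}({Σ tᵢ wᵢ | t ∈ [0,1]^{2p}}) = |det_{(u₀, i u₀, …)}(w)|` — `𝓗^{2p} ⌞ K` is the
Lebesgue measure of the `2p`-dimensional real inner product space `K` (Federer 3.2.3: the inclusion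
is an isometry) and the Lebesgue measure of a parallelepiped is the absolute determinant in an
orthonormal basis (Mathlib `addHaar_parallelepiped`). [cite: Federer1969, 3.2.3] -/
theorem measureReal_parallelepiped_eq_abs_det (hK : finrank ℂ K = p) {u : Fin p → V}
    (hu : Orthonormal ℂ u)
    (hspan : ((Submodule.span ℝ (Set.range (complexFrame u)) : Submodule ℝ V) : Set V) = (K : Set V))
    {w : Fin (2 * p) → V} (hw : ∀ i, w i ∈ K) :
    letI : InnerProductSpace ℝ K := InnerProductSpace.complexToReal
    (μHE[2 * p] : Measure V).real (parallelepiped w) =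
      |(complexFrameBasis K hK hu hspan).toBasis.det fun i ↦ (⟨w i, hw i⟩ : K)| := by
  letI iK : InnerProductSpace ℝ K := InnerProductSpace.complexToReal
  have hK2 : finrank ℝ K = 2 * p := by rw [finrank_real_of_complex, hK]
  have himg : parallelepiped w = ((↑) : K → V) '' parallelepiped (fun i ↦ (⟨w i, hw i⟩ : K)) := by
    have h := image_parallelepiped ((K.subtype).restrictScalars ℝ) (fun i ↦ (⟨w i, hw i⟩ : K))
    simp only [LinearMap.coe_restrictScalars, Submodule.coe_subtype] at h
    rw [h]
    rfl
  have hiso : Isometry ((↑) : K → V) := isometry_subtype_coe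
  have hvol : (μHE[2 * p] : Measure K) = volume := by
    have h : (μHE[finrank ℝ K] : Measure K) = volume := InnerProductSpace.euclideanHausdorffMeasure_eq_volume
    rwa [hK2] at h
  rw [Measure.real, himg, hiso.euclideanHausdorffMeasure_image, hvol,
    ← (complexFrameBasis K hK hu hspan).addHaar_eq_volume, Measure.addHaar_parallelepiped,
    ENNReal.toReal_ofReal (abs_nonneg _)]

/-! ### The period over the parallelotope of a frame -/

/-- **The period of the plane chain over the period parallelotope of a real frame of `K`**:
`constPeriod [K] (parallelepiped w) ω = |det_{(u,iu)}(w)| · ω(u₀, i u₀, …)`.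
[cite: Chirka1989, §14.1 Cor., p. 174] -/
theorem constPeriod_plane_parallelepiped_eq_abs_det_smul (hK : finrank ℂ K = p) {u : Fin p → V}
    (hu : Orthonormal ℂ u)
    (hspan : ((Submodule.span ℝ (Set.range (complexFrame u)) : Submodule ℝ V) : Set V) = (K : Set V))
    {w : Fin (2 * p) → V} (hw : ∀ i, w i ∈ K) (ω : V [⋀^Fin (2 * p)]→L[ℝ] ℂ) :
    letI : InnerProductSpace ℝ K := InnerProductSpace.complexToReal
    (plane K hK).constPeriod (parallelepiped w) ω =
      (|(complexFrameBasis K hK hu hspan).toBasis.det fun i ↦ (⟨w i, hw i⟩ : K)| : ℝ) •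
        ω (complexFrame u) := by
  letI iK : InnerProductSpace ℝ K := InnerProductSpace.complexToReal
  rw [constPeriod_plane_apply K hK hu hspan (isCompact_parallelepiped' w).isClosed.measurableSet
    subset_rfl (isCompact_parallelepiped' w) ω,
    inter_eq_left.2 (parallelepiped_subset K hw), measureReal_parallelepiped_eq_abs_det K hK hu hspan hw]

/-- **A positively oriented frame: the analytic period is the algebraic period.** For a real
`2p`-frame `w` of `K` which is POSITIVELY ORIENTED for the canonical complex orientation of `K`
(`IsPosOriented`, row p08: positive determinant in the interleaved real basis `(b₀, i b₀, …)` of a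
complex basis — the convention of `complexFrame`), the period of `[K]` over the parallelotope of `w` is
`ω(w₀, …, w_{2p-1})`: `|det| = det > 0` and `det · ω(u, iu, …) = ω(w)` — Voisin (2002), Cor. 11.15
(`⟨[Z], α⟩_X = ∫_Z α_{|Z}` with the complex orientation of `Z`). [cite: VoisinHodgeI2002, §11.1.2 Cor. 11.15] -/
theorem constPeriod_plane_parallelepiped (hK : finrank ℂ K = p) {w : Fin (2 * p) → V}
    (hw : ∀ i, w i ∈ K) (hpos : IsPosOriented fun i ↦ (⟨w i, hw i⟩ : K))
    (ω : V [⋀^Fin (2 * p)]→L[ℝ] ℂ) :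
    (plane K hK).constPeriod (parallelepiped w) ω = ω w := by
  obtain ⟨u, hu, hspan⟩ := exists_orthonormal_span_complexFrame_eq K hK
  rw [constPeriod_plane_parallelepiped_eq_abs_det_smul K hK hu hspan hw ω,
    abs_of_pos (det_complexFrameBasis_pos K hK hu hspan hpos),
    apply_eq_det_mul_apply_complexFrame K hK hu hspan hw ω, Complex.real_smul]

end Periods

end HolomorphicChain

/-! ### Stage (i): the plane chain of a complex sub-torus datum -/

namespace ComplexTorus

namespace SubtorusFrame

section Span

variable {ι : Type*} {E : Type*} [NormedAddCommGroup E] [NormedSpace ℂ E] {Φ : (ι → ℝ) ≃L[ℝ] E} {d : ℕ}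

/-- The complex span of the frame of a sub-torus datum `Z : SubtorusFrame Φ (2d)` has complex dimension
`d` (`2 dim_ℂ W = rk (W ∩ Λ)`). [cite: Lange2023AbelianVarietiesComplex, §1.1 Exercise 1.1.6 (2)(a)] -/
theorem finrank_frameSpan (Z : SubtorusFrame Φ (2 * d)) : finrank ℂ (frameSpan Φ Z.frame) = d := by
  have h := two_mul_finrank_span_complex_eq Z.linearIndependent fun i ↦
    Z.I_smul_mem_realSpan (Submodule.subset_span ⟨i, rfl⟩)
  change 2 * finrank ℂ (frameSpan Φ Z.frame) = 2 * d at h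
  omega

end Span

variable {ι : Type*} [Fintype ι] [DecidableEq ι] {E : Type u} [NormedAddCommGroup E]
  [InnerProductSpace ℂ E] [FiniteDimensional ℂ E] [MeasurableSpace E] [BorelSpace E]
  {Φ : (ι → ℝ) ≃L[ℝ] E} {d : ℕ}

omit [Fintype ι] [DecidableEq ι] in
/-- **The analytic period of the flat chain of a sub-torus is its algebraic period functional.** For a
complex sub-torus datum `Z : SubtorusFrame Φ (2d)` (row p08: a positively oriented saturated `ℤ`-basis
`u` of `W ∩ Λ`, `W = Σ ℂ Φuⱼ`), the period of the plane chain `[W]` (the universal cover of the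
sub-torus `W/(W ∩ Λ)`) on constant `2d`-forms over the fundamental parallelotope
`{Σ tⱼ Φuⱼ | t ∈ [0,1]^{2d}}` of `W ∩ Λ` is `ω ↦ ω(Φu₀, …, Φu_{2d-1})` — the `periodFunctional (Φu)` of
`ComplexTorusPoincareDualHodgeClass.lean` (Voisin (2002), Cor. 11.15: `⟨[Z], α⟩_X = ∫_Z α_{|Z}`).
[cite: VoisinHodgeI2002, §11.1.2 Cor. 11.15] -/
theorem constPeriod_plane_eq_periodFunctional (Z : SubtorusFrame Φ (2 * d)) :
    (HolomorphicChain.plane (frameSpan Φ Z.frame) Z.finrank_frameSpan).constPeriod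
        (parallelepiped (latticeTuple Φ Z.frame)) = periodFunctional (latticeTuple Φ Z.frame) := by
  refine LinearMap.ext fun ω ↦ ?_
  rw [periodFunctional_apply]
  exact HolomorphicChain.constPeriod_plane_parallelepiped (frameSpan Φ Z.frame) Z.finrank_frameSpan
    (fun i ↦ Submodule.subset_span ⟨i, rfl⟩) Z.posOriented ω

/-- **The stage-(ii) recipe reproduces the stage-(i) cycle class.** The Poincaré dual form of the
analytic period functional of the flat chain `[W]` over the fundamental parallelotope of `W ∩ Λ` is row
p08's cycle class of the sub-torus, up to the orientation sign of the enumeration `e` of the lattice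
basis: `(constPeriod [W] P)^♭ = sign(e) · cycleFormOfFrame` (`poincareDualForm_periodFunctional_latticeTuple`).
[cite: VoisinHodgeI2002, §11.1.2 Cor. 11.15] -/
theorem poincareDualForm_constPeriod_plane {n k : ℕ} (e : Fin n ≃ ι) (h : 2 * d + k = n)
    (Z : SubtorusFrame Φ (2 * d)) :
    poincareDualForm Φ e h
        ((HolomorphicChain.plane (frameSpan Φ Z.frame) Z.finrank_frameSpan).constPeriod
          (parallelepiped (latticeTuple Φ Z.frame))) =
      (orientationSign Φ ((finCongr h).trans e) : ℂ) •
        cycleFormOfFrame Φ ((finCongr h).trans e) Z.frame := by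
  rw [constPeriod_plane_eq_periodFunctional, poincareDualForm_periodFunctional_latticeTuple]

end SubtorusFrame

end ComplexTorus

end Literature.Geometry.Kaehler

end
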